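import Mathlib
import Summits.KontsevichZagierPeriods.Zeta5Search.BrickPropositionHTwoSharp
import Summits.KontsevichZagierPeriods.Zeta5Search.BrickDenominators

/-!
# BrickDenominatorsTwo — the Krattenthaler–Rivoal denominator exponent `A − 1 − s` AT THE PRIME `2`, and hence
THÉORÈME 1 of Krattenthaler–Rivoal (Mem. AMS 875, 2007) for the symmetric very-well-poised bricks `r = 1`, `C = 0`,
`A` even, EXACTLY AS PRINTED, at every prime: `d_n^{A−l−1}p_{l,n}(1) ∈ ℤ` (`1 ≤ l ≤ A−1`), `2d_n^{A−1}p_{0,0,n}(1) ∈ ℤ`;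
Zudilin 2002 at that strength: `uₙ ∈ ℤ`, `d_n²wₙ ∈ ℤ`, `2d_n⁵vₙ ∈ ℤ` (cell `pub-zeta5`, seat ct-1 g44)

HONEST FRAMING: systematic search; no irrationality claim unless certified.  INTEGRALITY statements about the rational
coefficients `x_s(n) = Σ_K c_{K,s}(n)`, `x_0(n)` of the very-well-poised brick linear forms
`Σ_{k≥1} R_n(k) = Σ_s x_s(n)ζ(s) + x_0(n)`, `R_n(t) = n!^{A−2B}(t + n/2)(t−n)_n^B(t+n+1)_n^B/(t)_{n+1}^A` (`BrickLinearForms`);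
at `(A,B) = (6,1)` Zudilin's `rₙ = uₙζ(5) + wₙζ(3) − vₙ` (Mat. Zametki **72** (2002), (7)).  The theorem in print since 2007
(Krattenthaler–Rivoal, *Hypergéométrie et fonction zêta de Riemann*, Mem. AMS **186** (2007) no. 875, §3 Théorème 1; arXiv:
math/0311114 p. 8; Zudilin (14): `2uₙ, 2D_n²wₙ, 2D_n⁵vₙ ∈ ℤ`) is reproduced here by a DIFFERENT ROUTE (2-adic digit pairing),
for `r = 1`, `C = 0`, `A` even only.  Nothing about the arithmetic nature of `ζ(5)`/`ζ(3)`; no `γ` / `μ` / denominator-law /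
record statement; records in print UNMOVED; the named fact `KrattenthalerRivoal2007.theoreme1` (all `A ≥ 2`, `C ≥ 0`, `r ≥ 0`)
is NOT discharged — only its body at `(C, r) = (0, 1)` under `Even A` is proved (`theoreme1_r_one`).  Theorems only (0 `def`).

THE ROUTE.  zi-eng's `BrickDenominators` proved the exponent at every ODD prime (`theoreme1_odd_prime`, from PROPOSITION H^∞
with the constant weight).  At `2` the centre factor `t + n/2` is split off pole by pole (ct-1 g41, here for general `(A,B)`):
`c_{K,s} = c̃_{K,s+1} + (n/2 − K)c̃_{K,s}` (`cell_one_eq`), so `x_s = x̃_{s+1} + ½W_s`, `x_0 = U + ½W_0` with the UNWEIGHTED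
centre-free sums 2-integral at the exponent `A − 1 − s` TERMWISE (`BrickCellsAllPrimes.cell_zero_valuation_abs`,
`BrickDigitStepDZero.hsum_valuation`) and the first antisymmetric moments `W_s = Σ_K (n − 2K)c̃_{K,s}` bounded by ct-1 g44's SHARP
PROPOSITION H at `2` (`BrickPropositionHTwoSharp.propositionH_two_sharp_linear`: `2^{ℓ(A−1−s)}W_s ∈ 2ℤ_(2)` for odd `s`;
even `s`: `W_s = 0`) and, for the harmonic moment, by ct-1 g43's `BrickPropositionHTwo.propositionH_two_linear`
(`2^{ℓ(A−1)}W_0 ∈ ℤ_(2)` — no spare factor: the printed `2` of Théorème 1 (ii) is genuine,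
`KrattenthalerRivoal2007.conjecture1_constantTerm_false`).

* `cell_one_eq`, `cell_one_top`, `xCoeff_one_eq`, `cellZero_one_eq`, `xZero_one_eq` — the decomposition (general `A, B`);
* `level_two_xCoeff`, `level_two_xZero` — `v₂(2^{ℓ(A−1−s)}x_s(n)) ≤ 1` (`1 ≤ s ≤ A−1`), `v₂(2·2^{ℓ(A−1)}x_0(n)) ≤ 1`, `n < 2^{ℓ+1}`;
* `padicValuation_lcmUpto_pow_mul_xCoeff_le`, `padicValuation_two_mul_lcmUpto_pow_mul_xZero_le` — with `d_n = lcm(1..n)`;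
* `theoreme1_two` — Théorème 1 (`r = 1`, `C = 0`, `A` even) at the prime `2`, in Krattenthaler–Rivoal's vocabulary;
* **`theoreme1_r_one`** — at EVERY prime, hence in `ℤ`: clause (i) `d_n^{A−l−1}p_{l,n}((−1)^A) ∈ ℤ` for `1 ≤ l ≤ A−1` and
  clause (ii) `2d_n^{A+0−1}p_{0,0,n}((−1)^A) ∈ ℤ`, for `A` even, `1 ≤ B`, `2B ≤ A`, every `n`, all data `c` of `R_{n,A,B,1}`;
* **`uC_isInt`, `lcmUpto_sq_mul_wC_isInt`, `two_mul_lcmUpto_pow_five_mul_vC_isInt`** — Zudilin 2002: `uₙ ∈ ℤ` (`uₙ = 1, 9, 469,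
  38601, …`), `d_n²wₙ ∈ ℤ`, `2d_n⁵vₙ ∈ ℤ`.
DATA (seat desk `alg/sharpcheck.py`, exact, not used by the kernel): (i) and (ii) verified on nine bricks, `n ≤ 20`; the factor `2`
of (ii) is used exactly at `n ∈ {1,2,4,8,16}` for `(A,B) ∈ {(2,1),(4,2),(6,2),(8,4)}` and never for `(6,1)`, `n ≤ 20`.
-/

namespace Summit.KontsevichZagierPeriods.Zeta5Search.BrickDenominatorsTwo

open Finset Nat WithZero
open Summit.KontsevichZagierPeriods.Zeta5Search.BrickLaurent (cell laurent)
open Summit.KontsevichZagierPeriods.Zeta5Search.BrickLaurentValuation (laurent_succ_succ laurent_succ_zero)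
open Summit.KontsevichZagierPeriods.Zeta5Search.BrickPartialFractions (cellZero xCoeff xZero)
open Summit.KontsevichZagierPeriods.Zeta5Search.BrickHarmonicBlocks (hsum)
open Summit.KontsevichZagierPeriods.Zeta5Search.BrickDigitStepDZero (cellZero_eq hsum_valuation)
open Summit.KontsevichZagierPeriods.Zeta5Search.BrickCellsAllPrimes (cell_zero_valuation_abs)
open Summit.KontsevichZagierPeriods.Zeta5Search.BrickResidueLawTwo (padicValuation_two padicValuation_two_pow)
open Summit.KontsevichZagierPeriods.Zeta5Search.BrickPropositionHTwo (propositionH_two_linear)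
open Summit.KontsevichZagierPeriods.Zeta5Search.BrickPropositionHTwoSharp (propositionH_two_sharp_linear
  weightedSum_eq_zero_of_even)
open Summit.KontsevichZagierPeriods.Zeta5Search.BrickDenominators (padicValuation_lcmUpto pCoeff_one_eq_xCoeff
  pZero_one_eq_xZero theoreme1_odd_prime padicValuation_uC_le padicValuation_lcmUpto_sq_mul_wC_le
  padicValuation_lcmUpto_pow_five_mul_vC_le)
open Summit.KontsevichZagierPeriods.Zeta5Search.Zudilin2002IntegralityTwoAdic (padicValuation_intCast_le_one
  exists_int_of_forall_padicValuation_le_one)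
open Summit.KontsevichZagierPeriods.Zeta5Search.BrickLinearForms (uC_eq_xCoeff wC_eq_xCoeff vC_eq_neg_xZero)
open Literature.NumberTheory.Irrationality.KrattenthalerRivoal2007 (IsPartialFractionData pCoeff pZero)
open Literature.NumberTheory.Irrationality.Zudilin2002 (uC wC vC)

noncomputable section

/-! ## The centre factor, pole by pole (general `A`, `B`) -/

/-- **`c_{K,s} = c̃_{K,s+1} + (n/2 − K)·c̃_{K,s}`** for `s ≤ A − 1`: the cell of the very-well-poised kernel `(A,B,1)`
against the cells `c̃ = cell A B 0` of the centre-free kernel (`t + n/2 = (t + K) + (n/2 − K)`). -/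
theorem cell_one_eq {A B : ℕ} (n K : ℕ) {s : ℕ} (hsA : s + 1 ≤ A) :
    cell A B 1 n K s = cell A B 0 n K (s + 1) + ((n : ℚ) / 2 - K) * cell A B 0 n K s := by
  obtain ⟨d, hd⟩ : ∃ d, A - s = d + 1 := ⟨A - s - 1, by omega⟩
  have h := laurent_succ_succ A B 0 n K d
  rw [zero_add] at h
  rw [cell, cell, cell, hd, show A - (s + 1) = d by omega, h]

/-- **`c_{K,A} = (n/2 − K)·c̃_{K,A}`** (top order: the centre factor only shifts). -/
theorem cell_one_top {A B : ℕ} (n K : ℕ) : cell A B 1 n K A = ((n : ℚ) / 2 - K) * cell A B 0 n K A := by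
  have h := laurent_succ_zero A B 0 n K
  rw [zero_add] at h
  rw [cell, cell, Nat.sub_self, h]

/-- **`x_s(n) = x̃_{s+1}(n) + ½·W_s(n)`**, `W_s(n) = Σ_K (n − 2K)·c̃_{K,s}(n)` (`s ≤ A − 1`). -/
theorem xCoeff_one_eq {A B : ℕ} (n : ℕ) {s : ℕ} (hsA : s + 1 ≤ A) :
    xCoeff A B 1 n s = xCoeff A B 0 n (s + 1) + 1 / 2 * ∑ K ∈ range (n + 1), ((n : ℚ) - 2 * K) * cell A B 0 n K s := by
  rw [xCoeff, xCoeff, Finset.mul_sum, ← Finset.sum_add_distrib]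
  exact Finset.sum_congr rfl fun K _ => by rw [cell_one_eq n K hsA]; ring

/-- **The harmonic cell**: `c⁰_K(n) = −Σ_{s=1}^{A−1} c̃_{K,s+1}H_K^{(s)} + (n/2 − K)·c̃⁰_K(n)` (`1 ≤ A`). -/
theorem cellZero_one_eq {A B : ℕ} (hA1 : 1 ≤ A) (n K : ℕ) :
    cellZero A B 1 n K = -(∑ s ∈ Icc 1 (A - 1), cell A B 0 n K (s + 1) * hsum s K) + ((n : ℚ) / 2 - K) * cellZero A B 0 n K := by
  obtain ⟨a, rfl⟩ : ∃ a, A = a + 1 := ⟨A - 1, by omega⟩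
  rw [cellZero_eq, cellZero_eq, Nat.add_sub_cancel, Finset.sum_Icc_succ_top (by omega : 1 ≤ a + 1),
    Finset.sum_Icc_succ_top (by omega : 1 ≤ a + 1), cell_one_top]
  have h : ∑ k ∈ Icc 1 a, cell (a + 1) B 1 n K k * hsum k K =
      ∑ s ∈ Icc 1 a, cell (a + 1) B 0 n K (s + 1) * hsum s K +
        ((n : ℚ) / 2 - K) * ∑ s ∈ Icc 1 a, cell (a + 1) B 0 n K s * hsum s K := by
    rw [Finset.mul_sum, ← Finset.sum_add_distrib]
    refine Finset.sum_congr rfl fun s hs => ?_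
    rw [cell_one_eq n K (by have := (mem_Icc.1 hs).2; omega : s + 1 ≤ a + 1)]
    ring
  rw [h]
  ring

/-- **`x_0(n) = U(n) + ½·W_0(n)`** with `U = −Σ_KΣ_{s=1}^{A−1} c̃_{K,s+1}H_K^{(s)}` and `W_0 = Σ_K (n − 2K)·c̃⁰_K(n)`. -/
theorem xZero_one_eq {A B : ℕ} (hA1 : 1 ≤ A) (n : ℕ) :
    xZero A B 1 n = -(∑ K ∈ range (n + 1), ∑ s ∈ Icc 1 (A - 1), cell A B 0 n K (s + 1) * hsum s K) +
      1 / 2 * ∑ K ∈ range (n + 1), ((n : ℚ) - 2 * K) * cellZero A B 0 n K := by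
  rw [xZero, Finset.mul_sum, ← Finset.sum_neg_distrib, ← Finset.sum_add_distrib]
  exact Finset.sum_congr rfl fun K _ => by rw [cellZero_one_eq hA1 n K]; ring

/-! ## At the prime `2` -/

section two

variable {A B : ℕ} (hA : Even A) (hB : 1 ≤ B) (hAB : 2 * B ≤ A)
include hAB

/-- Termwise: `v₂(2^{ℓ(A−s)}·c̃_{K,s}(n)) ≤ 1` for `n < 2^{ℓ+1}`, `K ≤ n` (`BrickCellsAllPrimes`). -/
theorem padicValuation_two_pow_mul_cell_le {ℓ n K : ℕ} (hn : n < 2 ^ (ℓ + 1)) (hK : K ≤ n) (s : ℕ) :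
    Rat.padicValuation 2 ((2 : ℚ) ^ (ℓ * (A - s)) * cell A B 0 n K s) ≤ 1 := by
  rw [map_mul, padicValuation_two_pow]
  calc _ ≤ exp (-((ℓ * (A - s) : ℕ) : ℤ)) * exp ((ℓ : ℤ) * (A - s : ℕ)) :=
        mul_le_mul' le_rfl (cell_zero_valuation_abs (p := 2) hAB hn hK s)
    _ = 1 := by rw [← exp_add, ← exp_zero]; congr 1; push_cast; ring

omit hAB in
/-- Termwise: `v₂(2^{ℓs}·H_K^{(s)}) ≤ 1` for `K ≤ n < 2^{ℓ+1}` (`BrickDigitStepDZero.hsum_valuation`). -/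
theorem padicValuation_two_pow_mul_hsum_le {ℓ n K : ℕ} (hn : n < 2 ^ (ℓ + 1)) (hK : K ≤ n) (s : ℕ) :
    Rat.padicValuation 2 ((2 : ℚ) ^ (ℓ * s) * hsum s K) ≤ 1 := by
  rw [map_mul, padicValuation_two_pow]
  calc _ ≤ exp (-((ℓ * s : ℕ) : ℤ)) * exp ((ℓ : ℤ) * s) :=
        mul_le_mul' le_rfl (hsum_valuation (p := 2) (lt_of_le_of_lt hK hn) s)
    _ = 1 := by rw [← exp_add, ← exp_zero]; congr 1; push_cast; ring

include hA hB

/-- **The exponent `A − 1 − s` at the prime `2`, level form**: for `n < 2^{ℓ+1}` and `s ≤ A − 1`,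
`v₂(2^{ℓ(A−1−s)}·x_s(n)) ≤ 1` (also, trivially, for `s = 0`).  The unweighted part `x̃_{s+1}` is integral termwise; for odd `s` the moment `½W_s` by the
SHARP Proposition H (`2^{ℓ(A−s)}W_s ∈ 2^{ℓ+1}ℤ_(2)`), for even `s` it vanishes. -/
theorem level_two_xCoeff {ℓ n : ℕ} (hn : n < 2 ^ (ℓ + 1)) {s : ℕ} (hsA : s + 1 ≤ A) :
    Rat.padicValuation 2 ((2 : ℚ) ^ (ℓ * (A - 1 - s)) * xCoeff A B 1 n s) ≤ 1 := by
  have htwo : (2 : ℚ) ^ (ℓ * (A - s)) = (2 : ℚ) ^ (ℓ * (A - 1 - s)) * (2 : ℚ) ^ ℓ := by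
    rw [← pow_add, show A - s = (A - 1 - s) + 1 by omega, Nat.mul_succ]
  rw [xCoeff_one_eq n hsA, mul_add]
  refine Valuation.map_add_le _ ?_ ?_
  · -- the unweighted part, termwise
    rw [xCoeff, Finset.mul_sum]
    refine Valuation.map_sum_le _ fun K hK => ?_
    rw [show A - 1 - s = A - (s + 1) by omega]
    exact padicValuation_two_pow_mul_cell_le hAB hn (by have := mem_range.1 hK; omega) (s + 1)
  · rcases Nat.even_or_odd s with hse | hso
    · -- even `s`: the moment vanishes
      have h0 : ∑ K ∈ range (n + 1), ((n : ℚ) - 2 * K) * cell A B 0 n K s = 0 := by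
        have h := weightedSum_eq_zero_of_even hA B (M := n) (g := fun k => (n : ℚ) - 2 * k) (fun k hk => by
          push_cast [Nat.cast_sub hk]; ring) (s := s) ((Nat.even_sub (by omega)).2 (iff_of_true hA hse)) 1
        simpa only [one_mul] using h
      rw [h0, mul_zero, mul_zero, map_zero]
      exact _root_.zero_le
    · -- odd `s`: the sharp Proposition H
      have hS := propositionH_two_sharp_linear hA hB hAB ℓ n hn hso (by omega)
      set S := ∑ k ∈ range (n + 1), ((n : ℚ) - 2 * k) * ((2 : ℚ) ^ (ℓ * (A - s)) * cell A B 0 n k s) with hSdef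
      have hW : ∑ K ∈ range (n + 1), ((n : ℚ) - 2 * K) * cell A B 0 n K s = ((2 : ℚ) ^ (ℓ * (A - s)))⁻¹ * S := by
        rw [hSdef, Finset.mul_sum]
        refine Finset.sum_congr rfl fun K _ => ?_
        rw [← mul_assoc, mul_comm (((2 : ℚ) ^ (ℓ * (A - s)))⁻¹), mul_assoc, inv_mul_cancel_left₀ (pow_ne_zero _ two_ne_zero)]
      rw [hW, htwo, mul_inv, one_div]
      rw [show (2 : ℚ) ^ (ℓ * (A - 1 - s)) * (2⁻¹ * (((2 : ℚ) ^ (ℓ * (A - 1 - s)))⁻¹ * ((2 : ℚ) ^ ℓ)⁻¹ * S)) =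
        2⁻¹ * (((2 : ℚ) ^ ℓ)⁻¹ * S) by field_simp]
      rw [map_mul, map_mul, map_inv₀, map_inv₀, padicValuation_two, padicValuation_two_pow, ← exp_neg, ← exp_neg, neg_neg,
        neg_neg]
      calc exp (1 : ℤ) * (exp (ℓ : ℤ) * Rat.padicValuation 2 S) ≤ exp (1 : ℤ) * (exp (ℓ : ℤ) * exp (-((ℓ : ℤ) + 1))) :=
            mul_le_mul' le_rfl (mul_le_mul' le_rfl hS)
        _ = 1 := by rw [← exp_add, ← exp_add, ← exp_zero]; congr 1; ring

/-- **The exponent `A − 1` for the constant term at `2`, WITH the factor `2`**: `v₂(2·2^{ℓ(A−1)}·x_0(n)) ≤ 1` for `n < 2^{ℓ+1}`. -/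
theorem level_two_xZero {ℓ n : ℕ} (hn : n < 2 ^ (ℓ + 1)) :
    Rat.padicValuation 2 (2 * ((2 : ℚ) ^ (ℓ * (A - 1)) * xZero A B 1 n)) ≤ 1 := by
  have hA1 : 1 ≤ A := by omega
  have htwo : (2 : ℚ) ^ (ℓ * A) = (2 : ℚ) ^ (ℓ * (A - 1)) * (2 : ℚ) ^ ℓ := by
    rw [← pow_add, show ℓ * A = ℓ * (A - 1) + ℓ by
      rw [show A = (A - 1) + 1 from (Nat.sub_add_cancel hA1).symm, Nat.mul_succ, Nat.add_sub_cancel]]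
  rw [xZero_one_eq hA1 n, mul_add, mul_add]
  refine Valuation.map_add_le _ ?_ ?_
  · -- `2·2^{ℓ(A−1)}·U`, termwise
    rw [mul_neg, mul_neg, Valuation.map_neg, Finset.mul_sum, Finset.mul_sum]
    refine Valuation.map_sum_le _ fun K hK => ?_
    have hKn : K ≤ n := by have := mem_range.1 hK; omega
    rw [Finset.mul_sum, Finset.mul_sum]
    refine Valuation.map_sum_le _ fun s hs => ?_
    have hs' := mem_Icc.1 hs
    rw [show (2 : ℚ) * ((2 : ℚ) ^ (ℓ * (A - 1)) * (cell A B 0 n K (s + 1) * hsum s K)) =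
      2 * (((2 : ℚ) ^ (ℓ * (A - (s + 1))) * cell A B 0 n K (s + 1)) * ((2 : ℚ) ^ (ℓ * s) * hsum s K)) by
        rw [show ℓ * (A - 1) = ℓ * (A - (s + 1)) + ℓ * s by rw [← Nat.mul_add]; congr 1; omega, pow_add]; ring,
      map_mul, map_mul]
    refine mul_le_one' (by rw [padicValuation_two, ← exp_zero, exp_le_exp]; norm_num)
      (mul_le_one' (padicValuation_two_pow_mul_cell_le hAB hn hKn (s + 1)) (padicValuation_two_pow_mul_hsum_le hn hKn s))
  · -- `2·2^{ℓ(A−1)}·½W_0 = 2^{−ℓ}·(2^{ℓA}W_0)`, Proposition H (harmonic clause)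
    have hS := (propositionH_two_linear hA hB hAB ℓ n hn).2
    set S := ∑ k ∈ range (n + 1), ((n : ℚ) - 2 * k) * ((2 : ℚ) ^ (ℓ * A) * cellZero A B 0 n k) with hSdef
    have hW : ∑ K ∈ range (n + 1), ((n : ℚ) - 2 * K) * cellZero A B 0 n K = ((2 : ℚ) ^ (ℓ * A))⁻¹ * S := by
      rw [hSdef, Finset.mul_sum]
      refine Finset.sum_congr rfl fun K _ => ?_
      rw [← mul_assoc, mul_comm (((2 : ℚ) ^ (ℓ * A))⁻¹), mul_assoc, inv_mul_cancel_left₀ (pow_ne_zero _ two_ne_zero)]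
    rw [hW, htwo, mul_inv, one_div]
    rw [show (2 : ℚ) * ((2 : ℚ) ^ (ℓ * (A - 1)) * (2⁻¹ * (((2 : ℚ) ^ (ℓ * (A - 1)))⁻¹ * ((2 : ℚ) ^ ℓ)⁻¹ * S))) =
      ((2 : ℚ) ^ ℓ)⁻¹ * S by field_simp]
    rw [map_mul, map_inv₀, padicValuation_two_pow, ← exp_neg, neg_neg]
    calc exp (ℓ : ℤ) * Rat.padicValuation 2 S ≤ exp (ℓ : ℤ) * exp (-(ℓ : ℤ)) := mul_le_mul' le_rfl hS
      _ = 1 := by rw [← exp_add, ← exp_zero]; congr 1; ring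

omit hA hB hAB in
/-- `v₂(d_n^m·x) = v₂(2^{⌊log₂n⌋·m}·x)` (`d_n = lcm(1,…,n)`, `2^{⌊log₂ n⌋} ∥ d_n`). -/
theorem padicValuation_lcmUpto_pow_mul (n m : ℕ) (x : ℚ) :
    Rat.padicValuation 2 (((Nat.lcmUpto n : ℕ) : ℚ) ^ m * x) = Rat.padicValuation 2 ((2 : ℚ) ^ (Nat.log 2 n * m) * x) := by
  rw [map_mul, map_mul, map_pow, padicValuation_lcmUpto, padicValuation_two_pow, ← exp_nsmul, nsmul_eq_mul]
  congr 2
  push_cast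
  ring

/-- **`d_n^{A−1−s}·x_s(n) ∈ ℤ_(2)`** (`s ≤ A − 1`; `A` even, `1 ≤ B ≤ A/2`): Krattenthaler–Rivoal's Théorème 1 (i) for
the very-well-poised bricks at the prime `2`. -/
theorem padicValuation_lcmUpto_pow_mul_xCoeff_le (n : ℕ) {s : ℕ} (hsA : s + 1 ≤ A) :
    Rat.padicValuation 2 (((Nat.lcmUpto n : ℕ) : ℚ) ^ (A - 1 - s) * xCoeff A B 1 n s) ≤ 1 := by
  rw [padicValuation_lcmUpto_pow_mul]
  exact level_two_xCoeff hA hB hAB (Nat.lt_pow_succ_log_self one_lt_two n) hsA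

/-- **`2·d_n^{A−1}·x_0(n) ∈ ℤ_(2)`**: Krattenthaler–Rivoal's Théorème 1 (ii) (`C = 0`) for the very-well-poised bricks at `2`. -/
theorem padicValuation_two_mul_lcmUpto_pow_mul_xZero_le (n : ℕ) :
    Rat.padicValuation 2 (2 * (((Nat.lcmUpto n : ℕ) : ℚ) ^ (A - 1) * xZero A B 1 n)) ≤ 1 := by
  rw [map_mul, padicValuation_lcmUpto_pow_mul, ← map_mul]
  exact level_two_xZero hA hB hAB (Nat.lt_pow_succ_log_self one_lt_two n)

/-! ## In Krattenthaler–Rivoal's vocabulary: Théorème 1 for `r = 1`, `C = 0`, `A` even -/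

section KR

/-- **Théorème 1 (`r = 1`, `C = 0`, `A` even) AT THE PRIME `2`**: for all partial-fraction data `c` of `R_{n,A,B,1}`:
(i) `v₂(d_n^{A−l−1}·p_{l,n}((−1)^A)) ≤ 1` for `1 ≤ l ≤ A−1`; (ii) `v₂(2·d_n^{A+0−1}·p_{0,0,n}((−1)^A)) ≤ 1`. -/
theorem theoreme1_two {n : ℕ} {c : ℕ → ℕ → ℚ} (hc : IsPartialFractionData n A B 1 c) :
    (∀ l : ℕ, 1 ≤ l → l + 1 ≤ A →
        Rat.padicValuation 2 (((Nat.lcmUpto n : ℕ) : ℚ) ^ (A - l - 1) * pCoeff n c l ((-1) ^ A)) ≤ 1) ∧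
      Rat.padicValuation 2 (2 * ((Nat.lcmUpto n : ℕ) : ℚ) ^ (A + 0 - 1) * pZero n A 0 c ((-1) ^ A)) ≤ 1 := by
  have hA1 : 1 < A := by omega
  have h1 : ((-1 : ℚ)) ^ A = 1 := hA.neg_one_pow
  refine ⟨fun l hl hlA => ?_, ?_⟩
  · rw [h1, pCoeff_one_eq_xCoeff hAB hA1 hc hl (by omega), show A - l - 1 = A - 1 - l by omega]
    exact padicValuation_lcmUpto_pow_mul_xCoeff_le hA hB hAB n hlA
  · rw [h1, pZero_one_eq_xZero hAB hA1 hc, Nat.add_zero, mul_assoc]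
    exact padicValuation_two_mul_lcmUpto_pow_mul_xZero_le hA hB hAB n

/-- **KRATTENTHALER–RIVOAL 2007, THÉORÈME 1, for `r = 1`, `C = 0`, `A` even, `1 ≤ B`, `2B ≤ A` — exactly as printed, as a
theorem of the tree**: for every `n` and all partial-fraction data `c` of `R_{n,A,B,1}`:
(i) `d_n^{A−l−1}·p_{l,n}((−1)^A) ∈ ℤ` for every `1 ≤ l ≤ A − 1`; (ii) `2·d_n^{A+0−1}·p_{0,0,n}((−1)^A) ∈ ℤ` (`d_n = lcm(1,…,n)`).
The odd primes are zi-eng's `BrickDenominators.theoreme1_odd_prime` (PROPOSITION H^∞, constant weight), the prime `2` is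
`theoreme1_two` (SHARP Proposition H at `2`).  This is the body of the named fact `KrattenthalerRivoal2007.theoreme1` at
`(C, r) = (0, 1)` under the extra hypothesis `Even A` (and with `2B ≤ A` in place of `2B < A`); the fact itself (all `C ≥ 0`,
`r ≥ 0`, `A ≥ 2`) is NOT discharged.  PROOF ROUTE ≠ PRINT (Andrews's multisum identity, KR §5).
[Krattenthaler–Rivoal, Mem. AMS 186 (2007) no. 875, §3 Théorème 1 (i)–(ii); arXiv:math/0311114 p. 8] -/
theorem theoreme1_r_one {n : ℕ} {c : ℕ → ℕ → ℚ} (hc : IsPartialFractionData n A B 1 c) :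
    (∀ l : ℕ, 1 ≤ l → l + 1 ≤ A →
        ∃ z : ℤ, ((Nat.lcmUpto n : ℕ) : ℚ) ^ (A - l - 1) * pCoeff n c l ((-1) ^ A) = z) ∧
      ∃ z : ℤ, 2 * ((Nat.lcmUpto n : ℕ) : ℚ) ^ (A + 0 - 1) * pZero n A 0 c ((-1) ^ A) = z := by
  refine ⟨fun l hl hlA => exists_int_of_forall_padicValuation_le_one fun p hp => ?_,
    exists_int_of_forall_padicValuation_le_one fun p hp => ?_⟩
  · by_cases hp2 : p = 2
    · subst hp2; exact (theoreme1_two hA hB hAB hc).1 l hl hlA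
    · exact (@theoreme1_odd_prime p ⟨hp⟩ hp2 A B hA hB hAB n c hc).1 l hl hlA
  · by_cases hp2 : p = 2
    · subst hp2; exact (theoreme1_two hA hB hAB hc).2
    · haveI : Fact p.Prime := ⟨hp⟩
      rw [mul_assoc, map_mul]
      exact mul_le_one' (by exact_mod_cast padicValuation_intCast_le_one p 2)
        ((theoreme1_odd_prime hp2 hA hB hAB hc).2)

end KR

end two

/-! ## Zudilin 2002 at Krattenthaler–Rivoal strength: `uₙ ∈ ℤ`, `d_n²wₙ ∈ ℤ`, `2d_n⁵vₙ ∈ ℤ` -/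

section Zudilin

/-- **`uₙ ∈ ℤ`** — Zudilin's `ζ(5)`-coefficient `uₙ = 1, 9, 469, 38601, …` of `rₙ = uₙζ(5) + wₙζ(3) − vₙ` (Math. Notes **72**
(2002), (7); print: `2uₙ ∈ ℤ` by (14), `uₙ ∈ ℤ` by Krattenthaler–Rivoal 2007 Théorème 1 (i) at `(A,B,l) = (6,1,5)`).  Odd primes:
`BrickDenominators.padicValuation_uC_le`; the prime `2`: the sharp Proposition H.  An integrality statement about rational
numbers — nothing about the arithmetic nature of `ζ(5)`. -/
theorem uC_isInt (n : ℕ) : ∃ z : ℤ, uC n = z := by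
  refine exists_int_of_forall_padicValuation_le_one fun p hp => ?_
  by_cases hp2 : p = 2
  · subst hp2
    have h := padicValuation_lcmUpto_pow_mul_xCoeff_le (A := 6) (B := 1) (by decide) le_rfl (by norm_num) n (s := 5)
      (by norm_num)
    rwa [show 6 - 1 - 5 = 0 from rfl, pow_zero, one_mul, ← uC_eq_xCoeff] at h
  · exact @padicValuation_uC_le p ⟨hp⟩ hp2 n

/-- **`d_n²·wₙ ∈ ℤ`** (Zudilin 2002 (14): `2D_n²wₙ ∈ ℤ`; Krattenthaler–Rivoal 2007: `d_n²wₙ ∈ ℤ`). -/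
theorem lcmUpto_sq_mul_wC_isInt (n : ℕ) : ∃ z : ℤ, ((Nat.lcmUpto n : ℕ) : ℚ) ^ 2 * wC n = z := by
  refine exists_int_of_forall_padicValuation_le_one fun p hp => ?_
  by_cases hp2 : p = 2
  · subst hp2
    have h := padicValuation_lcmUpto_pow_mul_xCoeff_le (A := 6) (B := 1) (by decide) le_rfl (by norm_num) n (s := 3)
      (by norm_num)
    rwa [show 6 - 1 - 3 = 2 from rfl, ← wC_eq_xCoeff] at h
  · exact @padicValuation_lcmUpto_sq_mul_wC_le p ⟨hp⟩ hp2 n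

/-- **`2·d_n⁵·vₙ ∈ ℤ`** (Zudilin 2002 (14): `2D_n⁵vₙ ∈ ℤ`; Krattenthaler–Rivoal 2007 Théorème 1 (ii): `2d_n⁵vₙ ∈ ℤ` — the
factor `2` stays, as in print). -/
theorem two_mul_lcmUpto_pow_five_mul_vC_isInt (n : ℕ) :
    ∃ z : ℤ, 2 * (((Nat.lcmUpto n : ℕ) : ℚ) ^ 5 * vC n) = z := by
  refine exists_int_of_forall_padicValuation_le_one fun p hp => ?_
  by_cases hp2 : p = 2
  · subst hp2
    have h := padicValuation_two_mul_lcmUpto_pow_mul_xZero_le (A := 6) (B := 1) (by decide) le_rfl (by norm_num) n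
    rwa [show 6 - 1 = 5 from rfl, ← Valuation.map_neg, ← mul_neg, ← mul_neg, ← vC_eq_neg_xZero] at h
  · haveI : Fact p.Prime := ⟨hp⟩
    rw [map_mul]
    exact mul_le_one' (by exact_mod_cast padicValuation_intCast_le_one p 2)
      (padicValuation_lcmUpto_pow_five_mul_vC_le hp2 n)

end Zudilin

end

end Summit.KontsevichZagierPeriods.Zeta5Search.BrickDenominatorsTwo
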